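import Mathlib.Analysis.SpecialFunctions.Exp
import Mathlib.Analysis.SpecialFunctions.Log.Basic
import Mathlib.Analysis.SpecificLimits.Basic
import Mathlib.Algebra.BigOperators.Intervals
import HarnessLib

/-!
# The Lawler–Werness combinatorial lemma for renewal sequences (Ann. Probab. 41 (2013), Lemma 4.15)

Topic `Probability/RandomPlanarGeometry`; theorems and three book-keeping abbreviations. In the proof
of Beffara's two-point estimate by G. F. Lawler and B. M. Werness, *Multi-point Green's functions for
SLE and an estimate of Beffara*, Ann. Probab. 41 (2013), §4.4, the renewal times of the SLE curve
around the two points produce *legal sequences* of triples `(i_l, j_l, R_l)` (dyadic scales of the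
distances to `z` and `w`, and which of them was halved): if `R_{l+1} = 0` then `i_{l+1} ≥ i_l + 1` and
`j_l ≤ j_{l+1} ≤ j_l + 1`; if `R_{l+1} = 1` then `i_l ≤ i_{l+1} ≤ i_l + 1` and `j_{l+1} ≥ j_l + 1`;
`K_l = i_{l-1}` if `R_l = 0` and `K_l = j_{l-1}` if `R_l = 1`. Their combinatorial input is

> **Lemma 4.15.** For every `α > 0` there exist `c` and `u > 0` such that for all `k`,
> `∑_{π ∈ seq_k(i,j,0)} ∏_{l=1}^k e^{-α K_l} ≤ c e^{-u k²}`,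

uniformly in the end point `(i, j)`. We prove it in the **recursive form** in which it is consumed
(one renewal step at a time, cf. the tree's chain bound `Literature.Probability.Process.ChainBound`):
if real arrays `F k i j`, `G k i j` (the sums over legal sequences of length `k` ending at
`(i, j, 0)`, resp. `(i, j, 1)` — or any upper bounds for the corresponding probabilities) satisfy
`F 0 + G 0 ≤ 1` and the one-step recursions read off from the legality rules,

  `F (k+1) i j ≤ ∑_{1 ≤ i' < i} e^{-α i'} (T k i' (j-1) + T k i' j)`,
  `G (k+1) i j ≤ ∑_{1 ≤ j' < j} e^{-α j'} (T k (i-1) j' + T k i j')`,     `T = F + G`,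

then `T k i j ≤ c e^{-u k²}` for all `k, i, j` with `u = α/8` (`sum_le_exp_neg_sq`). Taking
`F k i j := ∑_{π ∈ seq_k(i,j,0)} ∏_{l ≤ k} e^{-α K_l}` and `G k i j` the same sum over legal
sequences ending at `(i, j, 1)`, the legality rules give the two recursions with equality (a legal
sequence of length `k+1` ending at `(i,j,0)` is a legal sequence of length `k` ending at some
`(i', j', R')` with `1 ≤ i' ≤ i-1`, `j' ∈ {j-1, j}`, followed by a step of cost `e^{-α i'}`; dually
for `R = 1`) and `F 0 + G 0 = 1 + 0`, so the printed Lemma 4.15 is the case of equality; no sign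
condition on `F`, `G` is needed for the upper bound.

Proof (the quadratic gain of Lawler–Werness's `Σ_k ≤ c₁ e^{-α k²/4}`, organised as an induction
instead of their injection into pairs of strictly increasing sequences): with the profile
`Ψ_k(i,j) = ∑_{m ≤ k, m ≤ i, k-m ≤ j} exp(-α [m(m-1) + (k-m)(k-m-1)]/2)` (`psi`) one has
`T k i j ≤ B^k Ψ_k(i,j)`, `B = 4/(1 - e^{-α})` (`sum_le_pow_mul_psi`): an `R = 0` step from level `m`
sums `e^{-α i'}` over `i' ≥ m`, which costs `e^{-α m}/(1 - e^{-α})` and turns `m(m-1)/2` into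
`(m+1)m/2` (`sum_exp_mul_psi_le`), and symmetrically for `R = 1` steps. Finally
`m(m-1) + n(n-1) ≥ k²/2 - k` for `m + n = k`, and `(k+1) B^k e^{αk/2} e^{-α k²/4} ≤ e^{2L²/α} e^{-α k²/8}`,
`L = log B + 1 + α/2`.

## References

* G. F. Lawler, B. M. Werness, *Multi-point Green's functions for SLE and an estimate of Beffara*,
  Ann. Probab. 41 (2013) 1513–1555, arXiv:1011.3551, §4.4, Lemma 4.15 and its proof.
  [LawlerWerness2010]
-/

noncomputable section

open Finset Real

namespace Literature.Probability.RandomPlanarGeometry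

namespace RenewalPathSum

variable {α : ℝ}

/-- The triangular numbers `m(m-1)/2` (as reals): the minimal total cost `0 + 1 + ⋯ + (m-1)` of `m`
steps of one type. [cite: LawlerWerness2010, Lemma 4.15 (proof)] -/
def tri (m : ℕ) : ℝ := (m : ℝ) * ((m : ℝ) - 1) / 2

/-- The weight `exp(-α (tri m + tri n))` of `m` steps of type `0` and `n` steps of type `1`.
[cite: LawlerWerness2010, Lemma 4.15 (proof)] -/
def wt (α : ℝ) (m n : ℕ) : ℝ := Real.exp (-(α * (tri m + tri n)))

/-- The quadratic profile `Ψ_k(i,j) = ∑_{m ≤ k, m ≤ i, k-m ≤ j} exp(-α [m(m-1) + (k-m)(k-m-1)]/2)`.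
[cite: LawlerWerness2010, Lemma 4.15 (proof)] -/
def psi (α : ℝ) (k i j : ℕ) : ℝ :=
  ∑ m ∈ range (k + 1), if m ≤ i ∧ k - m ≤ j then wt α m (k - m) else 0

/-- `tri 0 = 0`. [folklore] -/
@[simp] theorem tri_zero : tri 0 = 0 := by simp [tri]

/-- `tri (m+1) = tri m + m`. [folklore] -/
theorem tri_succ (m : ℕ) : tri (m + 1) = tri m + m := by
  simp only [tri]; push_cast; ring

/-- `0 ≤ tri m`. [folklore] -/
theorem tri_nonneg (m : ℕ) : 0 ≤ tri m := by
  rcases Nat.eq_zero_or_pos m with rfl | hm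
  · simp
  · have : (1 : ℝ) ≤ m := by exact_mod_cast hm
    simp only [tri]; nlinarith

/-- `0 < wt`. [folklore] -/
theorem wt_pos (α : ℝ) (m n : ℕ) : 0 < wt α m n := Real.exp_pos _

/-- An `R = 0` step: `wt α m n · e^{-α m} = wt α (m+1) n`. [folklore] -/
theorem wt_mul_exp_left (α : ℝ) (m n : ℕ) : wt α m n * Real.exp (-(α * m)) = wt α (m + 1) n := by
  rw [wt, wt, ← Real.exp_add, tri_succ]; ring_nf

/-- An `R = 1` step: `wt α m n · e^{-α n} = wt α m (n+1)`. [folklore] -/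
theorem wt_mul_exp_right (α : ℝ) (m n : ℕ) : wt α m n * Real.exp (-(α * n)) = wt α m (n + 1) := by
  rw [wt, wt, ← Real.exp_add, tri_succ]; ring_nf

/-- `0 ≤ Ψ`. [folklore] -/
theorem psi_nonneg (α : ℝ) (k i j : ℕ) : 0 ≤ psi α k i j :=
  sum_nonneg fun m _ ↦ by split_ifs <;> [exact (wt_pos α _ _).le; exact le_rfl]

/-- **The geometric tail**: `∑_{1 ≤ i' < i, m ≤ i'} e^{-α i'} ≤ e^{-α m}/(1 - e^{-α})` (`α > 0`).
[folklore] -/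
theorem sum_filter_exp_le (hα : 0 < α) (m i : ℕ) :
    ∑ i' ∈ (Ico 1 i).filter (m ≤ ·), Real.exp (-(α * i')) ≤
      Real.exp (-(α * m)) / (1 - Real.exp (-α)) := by
  set q : ℝ := Real.exp (-α) with hq
  have hq0 : 0 ≤ q := (Real.exp_pos _).le
  have hq1 : q < 1 := Real.exp_lt_one_iff.2 (by linarith)
  have hterm : ∀ i' : ℕ, Real.exp (-(α * i')) = q ^ i' := by
    intro i'; rw [hq, ← Real.exp_nat_mul]; ring_nf
  have hsub : (Ico 1 i).filter (m ≤ ·) ⊆ (range i).image (m + ·) := by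
    intro i' hi'
    rw [mem_filter, mem_Ico] at hi'
    rw [mem_image]
    exact ⟨i' - m, mem_range.2 (by omega), by omega⟩
  calc ∑ i' ∈ (Ico 1 i).filter (m ≤ ·), Real.exp (-(α * i'))
      ≤ ∑ i' ∈ (range i).image (m + ·), Real.exp (-(α * i')) :=
        sum_le_sum_of_subset_of_nonneg hsub fun _ _ _ ↦ (Real.exp_pos _).le
    _ = ∑ t ∈ range i, Real.exp (-(α * ((m + t : ℕ) : ℝ))) := by
        rw [sum_image fun a _ b _ h ↦ Nat.add_left_cancel h]
    _ = Real.exp (-(α * m)) * ∑ t ∈ range i, q ^ t := by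
        rw [mul_sum]
        refine sum_congr rfl fun t _ ↦ ?_
        rw [hterm, hterm, ← pow_add]
    _ ≤ Real.exp (-(α * m)) * (1 - q)⁻¹ := by
        refine mul_le_mul_of_nonneg_left ?_ (Real.exp_pos _).le
        calc ∑ t ∈ range i, q ^ t ≤ ∑' t : ℕ, q ^ t :=
              (summable_geometric_of_lt_one hq0 hq1).sum_le_tsum _ fun _ _ ↦ pow_nonneg hq0 _
          _ = (1 - q)⁻¹ := tsum_geometric_of_lt_one hq0 hq1
    _ = Real.exp (-(α * m)) / (1 - Real.exp (-α)) := by rw [hq, div_eq_mul_inv]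

/-- **An `R = 0` step gains one level**: for `j'' ≤ j`,
`∑_{1 ≤ i' < i} e^{-α i'} Ψ_k(i', j'') ≤ Ψ_{k+1}(i, j)/(1 - e^{-α})`.
[cite: LawlerWerness2010, Lemma 4.15 (proof)] -/
theorem sum_exp_mul_psi_le (hα : 0 < α) (k i j : ℕ) {j'' : ℕ} (hj : j'' ≤ j) :
    ∑ i' ∈ Ico 1 i, Real.exp (-(α * i')) * psi α k i' j'' ≤ psi α (k + 1) i j / (1 - Real.exp (-α)) := by
  have hA : 0 < 1 - Real.exp (-α) := by
    have := Real.exp_lt_one_iff.2 (show -α < 0 by linarith); linarith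
  -- swap the sums
  have hswap : ∑ i' ∈ Ico 1 i, Real.exp (-(α * i')) * psi α k i' j'' =
      ∑ m ∈ range (k + 1), ∑ i' ∈ Ico 1 i,
        Real.exp (-(α * i')) * (if m ≤ i' ∧ k - m ≤ j'' then wt α m (k - m) else 0) := by
    simp only [psi, mul_sum]
    exact sum_comm
  rw [hswap]
  -- bound each `m`-term by the `(m+1)`-term of `Ψ_{k+1}(i,j)`
  have hm : ∀ m ∈ range (k + 1), ∑ i' ∈ Ico 1 i,
      Real.exp (-(α * i')) * (if m ≤ i' ∧ k - m ≤ j'' then wt α m (k - m) else 0) ≤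
      (if m + 1 ≤ i ∧ (k + 1) - (m + 1) ≤ j then wt α (m + 1) ((k + 1) - (m + 1)) else 0) /
        (1 - Real.exp (-α)) := by
    intro m _
    have hkm : (k + 1) - (m + 1) = k - m := by omega
    rw [hkm]
    by_cases hcase : m + 1 ≤ i ∧ k - m ≤ j
    · rw [if_pos hcase]
      calc ∑ i' ∈ Ico 1 i,
            Real.exp (-(α * i')) * (if m ≤ i' ∧ k - m ≤ j'' then wt α m (k - m) else 0)
          ≤ ∑ i' ∈ Ico 1 i, (if m ≤ i' then Real.exp (-(α * i')) else 0) * wt α m (k - m) := by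
            refine sum_le_sum fun i' _ ↦ ?_
            split_ifs with h1 h2 h2
            · exact le_rfl
            · exact absurd h1.1 h2
            · rw [mul_zero]; exact mul_nonneg (Real.exp_pos _).le (wt_pos α _ _).le
            · simp
        _ = (∑ i' ∈ (Ico 1 i).filter (m ≤ ·), Real.exp (-(α * i'))) * wt α m (k - m) := by
            rw [sum_mul, sum_filter]
            exact sum_congr rfl fun i' _ ↦ by rw [ite_mul, zero_mul]
        _ ≤ Real.exp (-(α * m)) / (1 - Real.exp (-α)) * wt α m (k - m) :=
            mul_le_mul_of_nonneg_right (sum_filter_exp_le hα m i) (wt_pos α _ _).le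
        _ = wt α (m + 1) (k - m) / (1 - Real.exp (-α)) := by
            rw [← wt_mul_exp_left]; ring
    · -- the term vanishes: either no `i' ∈ [1, i)` has `m ≤ i'`, or `k - m > j ≥ j''`
      rw [if_neg hcase, zero_div]
      refine (sum_eq_zero fun i' hi' ↦ ?_).le
      rw [mem_Ico] at hi'
      rw [if_neg, mul_zero]
      rintro ⟨h1, h2⟩
      exact hcase ⟨by omega, h2.trans hj⟩
  calc ∑ m ∈ range (k + 1), ∑ i' ∈ Ico 1 i,
        Real.exp (-(α * i')) * (if m ≤ i' ∧ k - m ≤ j'' then wt α m (k - m) else 0)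
      ≤ ∑ m ∈ range (k + 1),
          (if m + 1 ≤ i ∧ (k + 1) - (m + 1) ≤ j then wt α (m + 1) ((k + 1) - (m + 1)) else 0) /
            (1 - Real.exp (-α)) := sum_le_sum hm
    _ ≤ psi α (k + 1) i j / (1 - Real.exp (-α)) := by
        simp only [div_eq_mul_inv, ← sum_mul]
        refine mul_le_mul_of_nonneg_right ?_ (inv_nonneg.2 hA.le)
        rw [psi, sum_range_succ' _ (k + 1)]
        refine le_add_of_nonneg_right ?_
        split_ifs <;> [exact (wt_pos α _ _).le; exact le_rfl]

/-- **An `R = 1` step gains one level**: for `i'' ≤ i`,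
`∑_{1 ≤ j' < j} e^{-α j'} Ψ_k(i'', j') ≤ Ψ_{k+1}(i, j)/(1 - e^{-α})`.
[cite: LawlerWerness2010, Lemma 4.15 (proof)] -/
theorem sum_exp_mul_psi_le' (hα : 0 < α) (k i j : ℕ) {i'' : ℕ} (hi : i'' ≤ i) :
    ∑ j' ∈ Ico 1 j, Real.exp (-(α * j')) * psi α k i'' j' ≤ psi α (k + 1) i j / (1 - Real.exp (-α)) := by
  have hA : 0 < 1 - Real.exp (-α) := by
    have := Real.exp_lt_one_iff.2 (show -α < 0 by linarith); linarith
  have hswap : ∑ j' ∈ Ico 1 j, Real.exp (-(α * j')) * psi α k i'' j' =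
      ∑ m ∈ range (k + 1), ∑ j' ∈ Ico 1 j,
        Real.exp (-(α * j')) * (if m ≤ i'' ∧ k - m ≤ j' then wt α m (k - m) else 0) := by
    simp only [psi, mul_sum]
    exact sum_comm
  rw [hswap]
  have hm : ∀ m ∈ range (k + 1), ∑ j' ∈ Ico 1 j,
      Real.exp (-(α * j')) * (if m ≤ i'' ∧ k - m ≤ j' then wt α m (k - m) else 0) ≤
      (if m ≤ i ∧ (k + 1) - m ≤ j then wt α m ((k + 1) - m) else 0) / (1 - Real.exp (-α)) := by
    intro m hmk
    rw [mem_range] at hmk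
    have hkm : (k + 1) - m = (k - m) + 1 := by omega
    rw [hkm]
    by_cases hcase : m ≤ i ∧ k - m + 1 ≤ j
    · rw [if_pos hcase]
      calc ∑ j' ∈ Ico 1 j,
            Real.exp (-(α * j')) * (if m ≤ i'' ∧ k - m ≤ j' then wt α m (k - m) else 0)
          ≤ ∑ j' ∈ Ico 1 j, (if k - m ≤ j' then Real.exp (-(α * j')) else 0) * wt α m (k - m) := by
            refine sum_le_sum fun j' _ ↦ ?_
            split_ifs with h1 h2 h2
            · exact le_rfl
            · exact absurd h1.2 h2
            · rw [mul_zero]; exact mul_nonneg (Real.exp_pos _).le (wt_pos α _ _).le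
            · simp
        _ = (∑ j' ∈ (Ico 1 j).filter (k - m ≤ ·), Real.exp (-(α * j'))) * wt α m (k - m) := by
            rw [sum_mul, sum_filter]
            exact sum_congr rfl fun j' _ ↦ by rw [ite_mul, zero_mul]
        _ ≤ Real.exp (-(α * (k - m : ℕ))) / (1 - Real.exp (-α)) * wt α m (k - m) :=
            mul_le_mul_of_nonneg_right (sum_filter_exp_le hα (k - m) j) (wt_pos α _ _).le
        _ = wt α m (k - m + 1) / (1 - Real.exp (-α)) := by
            rw [← wt_mul_exp_right]; ring
    · rw [if_neg hcase, zero_div]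
      refine (sum_eq_zero fun j' hj' ↦ ?_).le
      rw [mem_Ico] at hj'
      rw [if_neg, mul_zero]
      rintro ⟨h1, h2⟩
      exact hcase ⟨h1.trans hi, by omega⟩
  calc ∑ m ∈ range (k + 1), ∑ j' ∈ Ico 1 j,
        Real.exp (-(α * j')) * (if m ≤ i'' ∧ k - m ≤ j' then wt α m (k - m) else 0)
      ≤ ∑ m ∈ range (k + 1),
          (if m ≤ i ∧ (k + 1) - m ≤ j then wt α m ((k + 1) - m) else 0) / (1 - Real.exp (-α)) :=
        sum_le_sum hm
    _ ≤ psi α (k + 1) i j / (1 - Real.exp (-α)) := by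
        simp only [div_eq_mul_inv, ← sum_mul]
        refine mul_le_mul_of_nonneg_right ?_ (inv_nonneg.2 hA.le)
        rw [psi, sum_range_succ _ (k + 1)]
        refine le_add_of_nonneg_right ?_
        split_ifs <;> [exact (wt_pos α _ _).le; exact le_rfl]

/-- **The inductive bound** `F k i j + G k i j ≤ B^k Ψ_k(i,j)`, `B = 4/(1 - e^{-α})`, for arrays
satisfying the one-step recursions of the legality rules and `F 0 + G 0 ≤ 1`.
[cite: LawlerWerness2010, Lemma 4.15 (proof)] -/
theorem sum_le_pow_mul_psi (hα : 0 < α) {F G : ℕ → ℕ → ℕ → ℝ} (h0 : ∀ i j, F 0 i j + G 0 i j ≤ 1)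
    (hF : ∀ k i j, F (k + 1) i j ≤ ∑ i' ∈ Ico 1 i, Real.exp (-(α * i')) *
      (F k i' (j - 1) + G k i' (j - 1) + (F k i' j + G k i' j)))
    (hG : ∀ k i j, G (k + 1) i j ≤ ∑ j' ∈ Ico 1 j, Real.exp (-(α * j')) *
      (F k (i - 1) j' + G k (i - 1) j' + (F k i j' + G k i j')))
    (k i j : ℕ) :
    F k i j + G k i j ≤ (4 / (1 - Real.exp (-α))) ^ k * psi α k i j := by
  have hA : 0 < 1 - Real.exp (-α) := by
    have := Real.exp_lt_one_iff.2 (show -α < 0 by linarith); linarith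
  set B : ℝ := 4 / (1 - Real.exp (-α)) with hB
  have hB0 : 0 ≤ B := by positivity
  induction k generalizing i j with
  | zero =>
    refine (h0 i j).trans ?_
    rw [pow_zero, one_mul, psi, sum_range_one]
    simp [wt]
  | succ k ih =>
    -- the two recursions, with the inductive bound inserted
    have hTk : ∀ i' j', F k i' j' + G k i' j' ≤ B ^ k * psi α k i' j' := ih
    have hF' : F (k + 1) i j ≤ B ^ k * (2 * (psi α (k + 1) i j / (1 - Real.exp (-α)))) := by
      refine (hF k i j).trans ?_
      calc ∑ i' ∈ Ico 1 i, Real.exp (-(α * i')) *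
            (F k i' (j - 1) + G k i' (j - 1) + (F k i' j + G k i' j))
          ≤ ∑ i' ∈ Ico 1 i, Real.exp (-(α * i')) *
              (B ^ k * psi α k i' (j - 1) + B ^ k * psi α k i' j) :=
            sum_le_sum fun i' _ ↦ mul_le_mul_of_nonneg_left (add_le_add (hTk _ _) (hTk _ _))
              (Real.exp_pos _).le
        _ = B ^ k * (∑ i' ∈ Ico 1 i, Real.exp (-(α * i')) * psi α k i' (j - 1) +
              ∑ i' ∈ Ico 1 i, Real.exp (-(α * i')) * psi α k i' j) := by
            rw [← sum_add_distrib, mul_sum]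
            exact sum_congr rfl fun i' _ ↦ by ring
        _ ≤ B ^ k * (psi α (k + 1) i j / (1 - Real.exp (-α)) +
              psi α (k + 1) i j / (1 - Real.exp (-α))) :=
            mul_le_mul_of_nonneg_left (add_le_add (sum_exp_mul_psi_le hα k i j (Nat.sub_le j 1))
              (sum_exp_mul_psi_le hα k i j le_rfl)) (pow_nonneg hB0 _)
        _ = B ^ k * (2 * (psi α (k + 1) i j / (1 - Real.exp (-α)))) := by ring
    have hG' : G (k + 1) i j ≤ B ^ k * (2 * (psi α (k + 1) i j / (1 - Real.exp (-α)))) := by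
      refine (hG k i j).trans ?_
      calc ∑ j' ∈ Ico 1 j, Real.exp (-(α * j')) *
            (F k (i - 1) j' + G k (i - 1) j' + (F k i j' + G k i j'))
          ≤ ∑ j' ∈ Ico 1 j, Real.exp (-(α * j')) *
              (B ^ k * psi α k (i - 1) j' + B ^ k * psi α k i j') :=
            sum_le_sum fun j' _ ↦ mul_le_mul_of_nonneg_left (add_le_add (hTk _ _) (hTk _ _))
              (Real.exp_pos _).le
        _ = B ^ k * (∑ j' ∈ Ico 1 j, Real.exp (-(α * j')) * psi α k (i - 1) j' +
              ∑ j' ∈ Ico 1 j, Real.exp (-(α * j')) * psi α k i j') := by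
            rw [← sum_add_distrib, mul_sum]
            exact sum_congr rfl fun j' _ ↦ by ring
        _ ≤ B ^ k * (psi α (k + 1) i j / (1 - Real.exp (-α)) +
              psi α (k + 1) i j / (1 - Real.exp (-α))) :=
            mul_le_mul_of_nonneg_left (add_le_add (sum_exp_mul_psi_le' hα k i j (Nat.sub_le i 1))
              (sum_exp_mul_psi_le' hα k i j le_rfl)) (pow_nonneg hB0 _)
        _ = B ^ k * (2 * (psi α (k + 1) i j / (1 - Real.exp (-α)))) := by ring
    calc F (k + 1) i j + G (k + 1) i j
        ≤ B ^ k * (2 * (psi α (k + 1) i j / (1 - Real.exp (-α)))) +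
            B ^ k * (2 * (psi α (k + 1) i j / (1 - Real.exp (-α)))) := add_le_add hF' hG'
      _ = B ^ (k + 1) * psi α (k + 1) i j := by rw [pow_succ, hB]; field_simp; ring

/-- **The profile is Gaussian in `k`**: `Ψ_k(i,j) ≤ (k+1) e^{αk/2} e^{-α k²/4}`, since
`m(m-1) + n(n-1) ≥ k²/2 - k` for `m + n = k`. [cite: LawlerWerness2010, Lemma 4.15 (proof)] -/
theorem psi_le (hα : 0 ≤ α) (k i j : ℕ) :
    psi α k i j ≤ (k + 1) * Real.exp (α * k / 2) * Real.exp (-(α * k ^ 2 / 4)) := by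
  have hterm : ∀ m ∈ range (k + 1), (if m ≤ i ∧ k - m ≤ j then wt α m (k - m) else 0) ≤
      Real.exp (α * k / 2) * Real.exp (-(α * k ^ 2 / 4)) := by
    intro m hm
    rw [mem_range] at hm
    have hquad : (k : ℝ) ^ 2 / 4 - k / 2 ≤ tri m + tri (k - m) := by
      have hmk : ((k - m : ℕ) : ℝ) = k - m := by rw [Nat.cast_sub (by omega)]
      simp only [tri, hmk]
      nlinarith [sq_nonneg ((m : ℝ) - ((k : ℝ) - m))]
    have hwt : wt α m (k - m) ≤ Real.exp (α * k / 2) * Real.exp (-(α * k ^ 2 / 4)) := by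
      rw [wt, ← Real.exp_add, Real.exp_le_exp]
      nlinarith
    split_ifs
    · exact hwt
    · exact (le_of_lt (by positivity))
  calc psi α k i j ≤ ∑ _m ∈ range (k + 1), Real.exp (α * k / 2) * Real.exp (-(α * k ^ 2 / 4)) :=
        sum_le_sum hterm
    _ = (k + 1) * Real.exp (α * k / 2) * Real.exp (-(α * k ^ 2 / 4)) := by
        rw [sum_const, card_range, nsmul_eq_mul]; push_cast; ring

/-- Completing the square: `e^{L k} e^{-α k²/4} ≤ e^{2L²/α} e^{-α k²/8}` (`α > 0`). [folklore] -/
theorem exp_mul_le (hα : 0 < α) (L : ℝ) (k : ℝ) :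
    Real.exp (L * k) * Real.exp (-(α * k ^ 2 / 4)) ≤
      Real.exp (2 * L ^ 2 / α) * Real.exp (-(α / 8 * k ^ 2)) := by
  rw [← Real.exp_add, ← Real.exp_add, Real.exp_le_exp]
  have h : 0 ≤ α / 8 * (k - 4 * L / α) ^ 2 := by positivity
  have h' : α / 8 * (k - 4 * L / α) ^ 2 = α / 8 * k ^ 2 - L * k + 2 * L ^ 2 / α := by
    field_simp; ring
  nlinarith

/-- **Lawler–Werness's Lemma 4.15 (recursive form).** For `α > 0` and real arrays `F`, `G` with
`F 0 + G 0 ≤ 1` satisfying the one-step recursions of the legality rules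
(`F (k+1) i j ≤ ∑_{1 ≤ i' < i} e^{-α i'} (T k i' (j-1) + T k i' j)`,
`G (k+1) i j ≤ ∑_{1 ≤ j' < j} e^{-α j'} (T k (i-1) j' + T k i j')`, `T = F + G`), there is `c`
(depending on `α` only) with `F k i j + G k i j ≤ c e^{-(α/8) k²}` for all `k, i, j` — "for every
`α > 0` there exist `c` and a `u > 0` such that for all `k`,
`∑_{π ∈ seq_k(i,j,0)} ∏_{l=1}^k e^{-α K_l} ≤ c e^{-u k²}`". [cite: LawlerWerness2010, Lemma 4.15] -/
theorem sum_le_exp_neg_sq (hα : 0 < α) :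
    ∃ c : ℝ, 0 < c ∧ ∀ {F G : ℕ → ℕ → ℕ → ℝ}, (∀ i j, F 0 i j + G 0 i j ≤ 1) →
      (∀ k i j, F (k + 1) i j ≤ ∑ i' ∈ Ico 1 i, Real.exp (-(α * i')) *
        (F k i' (j - 1) + G k i' (j - 1) + (F k i' j + G k i' j))) →
      (∀ k i j, G (k + 1) i j ≤ ∑ j' ∈ Ico 1 j, Real.exp (-(α * j')) *
        (F k (i - 1) j' + G k (i - 1) j' + (F k i j' + G k i j'))) →
      ∀ k i j, F k i j + G k i j ≤ c * Real.exp (-(α / 8 * (k : ℝ) ^ 2)) := by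
  have hA : 0 < 1 - Real.exp (-α) := by
    have := Real.exp_lt_one_iff.2 (show -α < 0 by linarith); linarith
  set B : ℝ := 4 / (1 - Real.exp (-α)) with hB
  have hB0 : 0 < B := by positivity
  set L : ℝ := Real.log B + 1 + α / 2 with hL
  refine ⟨Real.exp (2 * L ^ 2 / α), Real.exp_pos _, fun {F G} h0 hF hG k i j ↦ ?_⟩
  have h1 := sum_le_pow_mul_psi hα h0 hF hG k i j
  have h2 := psi_le hα.le k i j
  have hk1 : (k : ℝ) + 1 ≤ Real.exp k := by
    have := Real.add_one_le_exp (k : ℝ); linarith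
  -- `(k+1) B^k e^{αk/2} ≤ e^{L k}`
  have h3 : (k + 1) * (B ^ k * Real.exp (α * k / 2)) ≤ Real.exp (L * k) := by
    have hBk : B ^ k = Real.exp (Real.log B * k) := by
      rw [mul_comm, Real.exp_nat_mul, Real.exp_log hB0]
    rw [hBk, ← Real.exp_add, hL]
    calc (k + 1) * Real.exp (Real.log B * k + α * k / 2)
        ≤ Real.exp k * Real.exp (Real.log B * k + α * k / 2) :=
          mul_le_mul_of_nonneg_right hk1 (Real.exp_pos _).le
      _ = Real.exp ((Real.log B + 1 + α / 2) * k) := by rw [← Real.exp_add]; ring_nf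
  calc F k i j + G k i j ≤ B ^ k * psi α k i j := h1
    _ ≤ B ^ k * ((k + 1) * Real.exp (α * k / 2) * Real.exp (-(α * k ^ 2 / 4))) :=
        mul_le_mul_of_nonneg_left h2 (pow_nonneg hB0.le _)
    _ = (k + 1) * (B ^ k * Real.exp (α * k / 2)) * Real.exp (-(α * k ^ 2 / 4)) := by ring
    _ ≤ Real.exp (L * k) * Real.exp (-(α * k ^ 2 / 4)) :=
        mul_le_mul_of_nonneg_right h3 (Real.exp_pos _).le
    _ ≤ Real.exp (2 * L ^ 2 / α) * Real.exp (-(α / 8 * (k : ℝ) ^ 2)) := exp_mul_le hα L k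

end RenewalPathSum

end Literature.Probability.RandomPlanarGeometry
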